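import Summits.AtomisticToContinuum.HydrodynamicLimit.Theorems.EnskogAdjointDualityAdjointEnskogTestFamilyRPairGaussianMoments
import HarnessLib

/-!
# EnskogAdjointDuality / AdjointEnskogTestFamilyR — stub B3a helper 2: the pair integrals at equal parameters

Support lemmas for the Gaussian pair integrals of the collisional transfer (stub `stub_pairGaussian`
of the birth line of `Summit.AtomisticToContinuum.HydrodynamicLimit.Theses.EnskogAdjointDuality.AdjointEnskogTestFamilyR`,
stmt-AtomisticToContinuum-11592). With `q = (v − w)·ω`, `|ω| = 1`, `M = M_{1,θ,u}`:

* `k2r_kernel_fst_bound`, `k2r_kernel_fst_lipschitz`, `k2r_kernel_snd_bound`, `k2r_kernel_snd_lipschitz`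
  — cubic growth and local Lipschitz bounds (in the second velocity) of the kernels `q₊ q` and
  `q₊ q ((v+w)·ω/2)`;
* `k2r_pairGaussian_fst` — `∫∫ q₊ q M(v) M(w) dv dw = θ` (swap symmetry `(v,w) ↦ (w,v)`:
  `q₊ q + (−q)₊(−q) = q²`, and `∫∫ q² MM = 2θ` by the projection moments of `N(u, θ id)`);
* `k2r_pairGaussian_snd` — `∫∫ q₊ q ((v+w)·ω/2) M(v) M(w) dv dw = θ (u·ω)` (the involution
  `(v,w) ↦ (2u − w, 2u − v)` preserves Lebesgue measure, `M ⊗ M` and `q`, and flips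
  `((v−u)+(w−u))·ω`).

References: C. Cercignani, R. Illner, M. Pulvirenti, *The Mathematical Theory of Dilute Gases* (1994),
§3.1 [CIP1994]; S. Chapman, T. G. Cowling, *The Mathematical Theory of Non-uniform Gases* (1970), §16
[ChapmanCowling1970].
-/

noncomputable section

open MeasureTheory ProbabilityTheory Metric Set Filter Topology Function
open scoped InnerProductSpace ENNReal

namespace Summit.AtomisticToContinuum.HydrodynamicLimit.Theorems.EnskogAdjointDuality

open Literature.Analysis.FluidPDE Literature.MathematicalPhysics.KineticTheory

/-! ## Growth and Lipschitz bounds of the two kernels -/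

section Kernels

/-- Growth of the first kernel: `|q₊ q| ≤ (1 + ‖v‖ + ‖w‖)³`, `q = (v − w)·ω`, `|ω| = 1`. [folklore] -/
theorem k2r_kernel_fst_bound (ω : V3) (hω : ‖ω‖ = 1) (v w : V3) :
    |max ⟪v - w, ω⟫_ℝ 0 * ⟪v - w, ω⟫_ℝ| ≤ (1 + ‖v‖ + ‖w‖) ^ 3 := by
  have hq : |⟪v - w, ω⟫_ℝ| ≤ ‖v‖ + ‖w‖ :=
    (abs_real_inner_le_norm _ _).trans (by rw [hω, mul_one]; exact norm_sub_le v w)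
  have hS1 : 1 ≤ 1 + ‖v‖ + ‖w‖ := by linarith [norm_nonneg v, norm_nonneg w]
  calc |max ⟪v - w, ω⟫_ℝ 0 * ⟪v - w, ω⟫_ℝ| ≤ ⟪v - w, ω⟫_ℝ ^ 2 := k2r_abs_posMul_le _
    _ = |⟪v - w, ω⟫_ℝ| ^ 2 := (sq_abs _).symm
    _ ≤ (‖v‖ + ‖w‖) ^ 2 := pow_le_pow_left₀ (abs_nonneg _) hq 2
    _ ≤ (1 + ‖v‖ + ‖w‖) ^ 2 := pow_le_pow_left₀ (by positivity) (by linarith) 2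
    _ ≤ (1 + ‖v‖ + ‖w‖) ^ 3 := pow_le_pow_right₀ hS1 (by norm_num)

/-- Local Lipschitz bound of the first kernel in the second velocity:
`|q₊q − q'₊q'| ≤ 3 (1 + ‖v‖ + ‖w‖ + ‖w'‖)² ‖w − w'‖`. [folklore] -/
theorem k2r_kernel_fst_lipschitz (ω : V3) (hω : ‖ω‖ = 1) (v w w' : V3) :
    |max ⟪v - w, ω⟫_ℝ 0 * ⟪v - w, ω⟫_ℝ - max ⟪v - w', ω⟫_ℝ 0 * ⟪v - w', ω⟫_ℝ| ≤
      3 * (1 + ‖v‖ + ‖w‖ + ‖w'‖) ^ 2 * ‖w - w'‖ := by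
  have ha : |⟪v - w, ω⟫_ℝ| ≤ ‖v‖ + ‖w‖ :=
    (abs_real_inner_le_norm _ _).trans (by rw [hω, mul_one]; exact norm_sub_le v w)
  have hb : |⟪v - w', ω⟫_ℝ| ≤ ‖v‖ + ‖w'‖ :=
    (abs_real_inner_le_norm _ _).trans (by rw [hω, mul_one]; exact norm_sub_le v w')
  have hab : |⟪v - w, ω⟫_ℝ - ⟪v - w', ω⟫_ℝ| ≤ ‖w - w'‖ := by
    rw [← inner_sub_left, show v - w - (v - w') = -(w - w') by abel, inner_neg_left, abs_neg]
    exact (abs_real_inner_le_norm _ _).trans (by rw [hω, mul_one])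
  have hS1 : 1 ≤ 1 + ‖v‖ + ‖w‖ + ‖w'‖ := by linarith [norm_nonneg v, norm_nonneg w, norm_nonneg w']
  calc |max ⟪v - w, ω⟫_ℝ 0 * ⟪v - w, ω⟫_ℝ - max ⟪v - w', ω⟫_ℝ 0 * ⟪v - w', ω⟫_ℝ|
      ≤ (|⟪v - w, ω⟫_ℝ| + |⟪v - w', ω⟫_ℝ|) * |⟪v - w, ω⟫_ℝ - ⟪v - w', ω⟫_ℝ| :=
        k2r_abs_posMul_sub_posMul_le _ _
    _ ≤ (2 * (1 + ‖v‖ + ‖w‖ + ‖w'‖)) * ‖w - w'‖ :=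
        mul_le_mul (by linarith [norm_nonneg v, norm_nonneg w, norm_nonneg w']) hab (abs_nonneg _)
          (by positivity)
    _ ≤ 3 * (1 + ‖v‖ + ‖w‖ + ‖w'‖) ^ 2 * ‖w - w'‖ := by
        apply mul_le_mul_of_nonneg_right _ (norm_nonneg _)
        nlinarith

/-- Growth of the second kernel: `|q₊ q ((v+w)·ω/2)| ≤ (1 + ‖v‖ + ‖w‖)³`. [folklore] -/
theorem k2r_kernel_snd_bound (ω : V3) (hω : ‖ω‖ = 1) (v w : V3) :
    |max ⟪v - w, ω⟫_ℝ 0 * ⟪v - w, ω⟫_ℝ * (⟪v + w, ω⟫_ℝ / 2)| ≤ (1 + ‖v‖ + ‖w‖) ^ 3 := by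
  have hq : |⟪v - w, ω⟫_ℝ| ≤ ‖v‖ + ‖w‖ :=
    (abs_real_inner_le_norm _ _).trans (by rw [hω, mul_one]; exact norm_sub_le v w)
  have hs : |⟪v + w, ω⟫_ℝ| ≤ ‖v‖ + ‖w‖ :=
    (abs_real_inner_le_norm _ _).trans (by rw [hω, mul_one]; exact norm_add_le v w)
  have h1 : |max ⟪v - w, ω⟫_ℝ 0 * ⟪v - w, ω⟫_ℝ| ≤ (‖v‖ + ‖w‖) ^ 2 := by
    refine (k2r_abs_posMul_le _).trans ?_
    rw [← sq_abs]
    exact pow_le_pow_left₀ (abs_nonneg _) hq 2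
  have h2 : |⟪v + w, ω⟫_ℝ / 2| ≤ ‖v‖ + ‖w‖ := by
    rw [abs_div, abs_two]
    linarith [abs_nonneg ⟪v + w, ω⟫_ℝ]
  rw [abs_mul]
  calc |max ⟪v - w, ω⟫_ℝ 0 * ⟪v - w, ω⟫_ℝ| * |⟪v + w, ω⟫_ℝ / 2|
      ≤ (‖v‖ + ‖w‖) ^ 2 * (‖v‖ + ‖w‖) := mul_le_mul h1 h2 (abs_nonneg _) (by positivity)
    _ ≤ (1 + ‖v‖ + ‖w‖) ^ 2 * (1 + ‖v‖ + ‖w‖) := by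
        gcongr <;> linarith [norm_nonneg v, norm_nonneg w]
    _ = (1 + ‖v‖ + ‖w‖) ^ 3 := by ring

/-- Local Lipschitz bound of the second kernel in the second velocity:
`|q₊q s − q'₊q' s'| ≤ 3 (1 + ‖v‖ + ‖w‖ + ‖w'‖)² ‖w − w'‖`, `s = (v+w)·ω/2`. [folklore] -/
theorem k2r_kernel_snd_lipschitz (ω : V3) (hω : ‖ω‖ = 1) (v w w' : V3) :
    |max ⟪v - w, ω⟫_ℝ 0 * ⟪v - w, ω⟫_ℝ * (⟪v + w, ω⟫_ℝ / 2) -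
        max ⟪v - w', ω⟫_ℝ 0 * ⟪v - w', ω⟫_ℝ * (⟪v + w', ω⟫_ℝ / 2)| ≤
      3 * (1 + ‖v‖ + ‖w‖ + ‖w'‖) ^ 2 * ‖w - w'‖ := by
  set S : ℝ := 1 + ‖v‖ + ‖w‖ + ‖w'‖ with hS
  have hS1 : 1 ≤ S := by rw [hS]; linarith [norm_nonneg v, norm_nonneg w, norm_nonneg w']
  set φa : ℝ := max ⟪v - w, ω⟫_ℝ 0 * ⟪v - w, ω⟫_ℝ with hφa
  set φb : ℝ := max ⟪v - w', ω⟫_ℝ 0 * ⟪v - w', ω⟫_ℝ with hφb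
  set sa : ℝ := ⟪v + w, ω⟫_ℝ / 2 with hsa
  set sb : ℝ := ⟪v + w', ω⟫_ℝ / 2 with hsb
  have h1 : |φa - φb| ≤ 2 * S * ‖w - w'‖ := by
    have ha : |⟪v - w, ω⟫_ℝ| ≤ ‖v‖ + ‖w‖ :=
      (abs_real_inner_le_norm _ _).trans (by rw [hω, mul_one]; exact norm_sub_le v w)
    have hb : |⟪v - w', ω⟫_ℝ| ≤ ‖v‖ + ‖w'‖ :=
      (abs_real_inner_le_norm _ _).trans (by rw [hω, mul_one]; exact norm_sub_le v w')
    have hab : |⟪v - w, ω⟫_ℝ - ⟪v - w', ω⟫_ℝ| ≤ ‖w - w'‖ := by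
      rw [← inner_sub_left, show v - w - (v - w') = -(w - w') by abel, inner_neg_left, abs_neg]
      exact (abs_real_inner_le_norm _ _).trans (by rw [hω, mul_one])
    calc |φa - φb| ≤ (|⟪v - w, ω⟫_ℝ| + |⟪v - w', ω⟫_ℝ|) * |⟪v - w, ω⟫_ℝ - ⟪v - w', ω⟫_ℝ| :=
          k2r_abs_posMul_sub_posMul_le _ _
      _ ≤ (2 * S) * ‖w - w'‖ :=
          mul_le_mul (by rw [hS]; linarith [norm_nonneg v, norm_nonneg w, norm_nonneg w']) hab
            (abs_nonneg _) (by positivity)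
  have h2 : |sa| ≤ S / 2 := by
    have hs : |⟪v + w, ω⟫_ℝ| ≤ ‖v‖ + ‖w‖ :=
      (abs_real_inner_le_norm _ _).trans (by rw [hω, mul_one]; exact norm_add_le v w)
    rw [hsa, abs_div, abs_two, hS]
    linarith [norm_nonneg w']
  have h3 : |φb| ≤ S ^ 2 := by
    have hb : |⟪v - w', ω⟫_ℝ| ≤ ‖v‖ + ‖w'‖ :=
      (abs_real_inner_le_norm _ _).trans (by rw [hω, mul_one]; exact norm_sub_le v w')
    calc |φb| ≤ ⟪v - w', ω⟫_ℝ ^ 2 := k2r_abs_posMul_le _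
      _ = |⟪v - w', ω⟫_ℝ| ^ 2 := (sq_abs _).symm
      _ ≤ (‖v‖ + ‖w'‖) ^ 2 := pow_le_pow_left₀ (abs_nonneg _) hb 2
      _ ≤ S ^ 2 := pow_le_pow_left₀ (by positivity) (by rw [hS]; linarith [norm_nonneg w]) 2
  have h4 : |sa - sb| ≤ ‖w - w'‖ / 2 := by
    rw [hsa, hsb, ← sub_div, abs_div, abs_two, ← inner_sub_left,
      show v + w - (v + w') = w - w' by abel]
    have := (abs_real_inner_le_norm (w - w') ω).trans (by rw [hω, mul_one])
    linarith
  calc |φa * sa - φb * sb| = |(φa - φb) * sa + φb * (sa - sb)| := by ring_nf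
    _ ≤ |(φa - φb) * sa| + |φb * (sa - sb)| := abs_add_le _ _
    _ = |φa - φb| * |sa| + |φb| * |sa - sb| := by rw [abs_mul, abs_mul]
    _ ≤ 2 * S * ‖w - w'‖ * (S / 2) + S ^ 2 * (‖w - w'‖ / 2) :=
        add_le_add (mul_le_mul h1 h2 (abs_nonneg _) (by positivity))
          (mul_le_mul h3 h4 (abs_nonneg _) (by positivity))
    _ ≤ 3 * S ^ 2 * ‖w - w'‖ := by nlinarith [norm_nonneg (w - w'), sq_nonneg S]

end Kernels

/-! ## The pair integrals at equal parameters -/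

section Equal

local notation "vol2" => (MeasureTheory.Measure.prod (volume : Measure V3) (volume : Measure V3))

/-- Continuity of the pair kernel `(v, w) ↦ ((v−w)·ω)₊ ((v−w)·ω)`. [folklore] -/
theorem k2r_continuous_posMul_kernel (ω : V3) :
    Continuous fun p : V3 × V3 => max ⟪p.1 - p.2, ω⟫_ℝ 0 * ⟪p.1 - p.2, ω⟫_ℝ := by
  have hq : Continuous fun p : V3 × V3 => ⟪p.1 - p.2, ω⟫_ℝ :=
    (continuous_fst.sub continuous_snd).inner continuous_const
  exact (hq.max continuous_const).mul hq

/-- **B3a (i): `∫∫ q₊ q M(v) M(w) dv dw = θ`** for `q = (v − w)·ω`, `M = M_{1,θ,u}`, `|ω| = 1`.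
The swap `(v, w) ↦ (w, v)` preserves `M ⊗ M` and sends `q ↦ −q`; since `q₊ q + (−q)₊(−q) = q²`,
`2 ∫∫ q₊ q MM = ∫∫ q² MM = Var + Var = 2θ` (projection moments of `N(u, θ id)`). [cite: CIP1994, §3.1] -/
theorem k2r_pairGaussian_fst {θ : ℝ} (hθ : 0 < θ) (u : V3) (ω : sphere (0 : V3) 1) :
    ∫ v, ∫ w, max ⟪v - w, (ω : V3)⟫_ℝ 0 * ⟪v - w, (ω : V3)⟫_ℝ *
        (localMaxwellian 1 θ u v * localMaxwellian 1 θ u w) = θ := by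
  have hω : ‖(ω : V3)‖ = 1 := norm_eq_of_mem_sphere ω
  set M : V3 → ℝ := localMaxwellian 1 θ u with hM
  set F : V3 × V3 → ℝ := fun p =>
    max ⟪p.1 - p.2, (ω : V3)⟫_ℝ 0 * ⟪p.1 - p.2, (ω : V3)⟫_ℝ * (M p.1 * M p.2) with hF
  set Q : V3 × V3 → ℝ := fun p => ⟪p.1 - p.2, (ω : V3)⟫_ℝ ^ 2 * (M p.1 * M p.2) with hQ
  have hFi : Integrable F vol2 := by
    refine k2r_integrable_weight_mul_localMaxwellian_prod hθ hθ u u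
      (k2r_continuous_posMul_kernel (ω : V3)).aestronglyMeasurable (C := 1) (m := 2) (fun p => ?_)
    refine (k2r_abs_posMul_le _).trans ?_
    rw [one_mul, ← sq_abs]
    exact pow_le_pow_left₀ (abs_nonneg _) (k2r_abs_inner_sub_le p.1 p.2 _ hω) 2
  have hQi : Integrable Q vol2 := by
    refine k2r_integrable_weight_mul_localMaxwellian_prod hθ hθ u u
      (((continuous_fst.sub continuous_snd).inner continuous_const).pow 2).aestronglyMeasurable
      (C := 1) (m := 2) (fun p => ?_)
    rw [one_mul, abs_pow, ← sq_abs, abs_abs]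
    exact pow_le_pow_left₀ (abs_nonneg _) (k2r_abs_inner_sub_le p.1 p.2 _ hω) 2
  -- the registered iterated integral is the product integral of `F`
  have hJF : (∫ v, ∫ w, max ⟪v - w, (ω : V3)⟫_ℝ 0 * ⟪v - w, (ω : V3)⟫_ℝ * (M v * M w)) =
      ∫ p, F p ∂vol2 := (integral_prod F hFi).symm
  -- swap symmetry: `∫ Q = 2 ∫ F`
  have hsum : ∀ p : V3 × V3, F p + F p.swap = Q p := by
    intro p
    simp only [hF, hQ, Prod.fst_swap, Prod.snd_swap]
    rw [← neg_sub p.1 p.2, inner_neg_left, ← k2r_posMul_add_posMul_neg]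
    ring
  have h2 : ∫ p, Q p ∂vol2 = 2 * ∫ p, F p ∂vol2 := by
    have hswap' : Integrable (fun p : V3 × V3 => F p.swap) vol2 := hFi.swap
    calc ∫ p, Q p ∂vol2 = ∫ p, (F p + F p.swap) ∂vol2 :=
          integral_congr_ae (Eventually.of_forall fun p => (hsum p).symm)
      _ = (∫ p, F p ∂vol2) + ∫ p, F p.swap ∂vol2 := integral_add hFi hswap'
      _ = (∫ p, F p ∂vol2) + ∫ p, F p ∂vol2 := by rw [integral_prod_swap F]
      _ = 2 * ∫ p, F p ∂vol2 := by ring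
  -- Gaussian moments: `∫ Q = 2θ`
  have hinner : ∀ v : V3, ∫ w, Q (v, w) = M v * (⟪v - u, (ω : V3)⟫_ℝ ^ 2 + θ) := by
    intro v
    have h := k2r_integral_localMaxwellian_mul_quadratic hθ u (ω : V3) (⟪v - u, (ω : V3)⟫_ℝ ^ 2)
      (-2 * ⟪v - u, (ω : V3)⟫_ℝ) 1
    rw [hω, one_pow, mul_one, one_mul] at h
    rw [← h, ← integral_const_mul]
    refine integral_congr_ae (Eventually.of_forall fun w => ?_)
    simp only [hQ]
    have hvw : ⟪v - w, (ω : V3)⟫_ℝ = ⟪v - u, (ω : V3)⟫_ℝ - ⟪w - u, (ω : V3)⟫_ℝ := by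
      rw [← inner_sub_left]
      congr 1
      abel
    rw [hvw]
    ring
  have houter : ∫ v, M v * (⟪v - u, (ω : V3)⟫_ℝ ^ 2 + θ) = 2 * θ := by
    have h := k2r_integral_localMaxwellian_mul_quadratic hθ u (ω : V3) θ 0 1
    rw [hω, one_pow, mul_one, one_mul] at h
    rw [show 2 * θ = θ + θ by ring, ← h]
    refine integral_congr_ae (Eventually.of_forall fun v => ?_)
    ring
  have hQval : ∫ p, Q p ∂vol2 = 2 * θ := by
    rw [integral_prod Q hQi]
    simp_rw [hinner]
    exact houter
  rw [hJF]
  linarith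

/-- **B3a (ii): `∫∫ q₊ q ((v+w)·ω/2) M(v) M(w) dv dw = θ (u·ω)`.** Writing
`(v+w)·ω/2 = u·ω + ((v−u)+(w−u))·ω/2`, the first piece is `(u·ω) · θ` by (i), and the second vanishes:
the involution `(v, w) ↦ (2u − w, 2u − v)` preserves Lebesgue measure, `M ⊗ M` and `q`, and flips the
sign of `((v−u)+(w−u))·ω`. [cite: CIP1994, §3.1] -/
theorem k2r_pairGaussian_snd {θ : ℝ} (hθ : 0 < θ) (u : V3) (ω : sphere (0 : V3) 1) :
    ∫ v, ∫ w, max ⟪v - w, (ω : V3)⟫_ℝ 0 * ⟪v - w, (ω : V3)⟫_ℝ * (⟪v + w, (ω : V3)⟫_ℝ / 2) *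
        (localMaxwellian 1 θ u v * localMaxwellian 1 θ u w) = θ * ⟪u, (ω : V3)⟫_ℝ := by
  have hω : ‖(ω : V3)‖ = 1 := norm_eq_of_mem_sphere ω
  set M : V3 → ℝ := localMaxwellian 1 θ u with hM
  set F : V3 × V3 → ℝ := fun p =>
    max ⟪p.1 - p.2, (ω : V3)⟫_ℝ 0 * ⟪p.1 - p.2, (ω : V3)⟫_ℝ * (M p.1 * M p.2) with hF
  set G : V3 × V3 → ℝ := fun p =>
    max ⟪p.1 - p.2, (ω : V3)⟫_ℝ 0 * ⟪p.1 - p.2, (ω : V3)⟫_ℝ * (⟪p.1 + p.2, (ω : V3)⟫_ℝ / 2) *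
      (M p.1 * M p.2) with hG
  set H : V3 × V3 → ℝ := fun p =>
    max ⟪p.1 - p.2, (ω : V3)⟫_ℝ 0 * ⟪p.1 - p.2, (ω : V3)⟫_ℝ * (⟪(p.1 - u) + (p.2 - u), (ω : V3)⟫_ℝ / 2) *
      (M p.1 * M p.2) with hH
  have hk := k2r_continuous_posMul_kernel (ω : V3)
  have hFi : Integrable F vol2 := by
    refine k2r_integrable_weight_mul_localMaxwellian_prod hθ hθ u u hk.aestronglyMeasurable
      (C := 1) (m := 2) (fun p => ?_)
    refine (k2r_abs_posMul_le _).trans ?_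
    rw [one_mul, ← sq_abs]
    exact pow_le_pow_left₀ (abs_nonneg _) (k2r_abs_inner_sub_le p.1 p.2 _ hω) 2
  have hGi : Integrable G vol2 := by
    have hc : Continuous fun p : V3 × V3 =>
        max ⟪p.1 - p.2, (ω : V3)⟫_ℝ 0 * ⟪p.1 - p.2, (ω : V3)⟫_ℝ * (⟪p.1 + p.2, (ω : V3)⟫_ℝ / 2) :=
      hk.mul (((continuous_fst.add continuous_snd).inner continuous_const).div_const _)
    refine k2r_integrable_weight_mul_localMaxwellian_prod hθ hθ u u hc.aestronglyMeasurable
      (C := 1) (m := 3) (fun p => ?_)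
    set X : ℝ := (1 + ‖p.1‖) * (1 + ‖p.2‖) with hX
    have hX1 : 1 ≤ X := by
      rw [hX]; nlinarith [norm_nonneg p.1, norm_nonneg p.2, mul_nonneg (norm_nonneg p.1) (norm_nonneg p.2)]
    have h1 : |max ⟪p.1 - p.2, (ω : V3)⟫_ℝ 0 * ⟪p.1 - p.2, (ω : V3)⟫_ℝ| ≤ X ^ 2 := by
      refine (k2r_abs_posMul_le _).trans ?_
      rw [← sq_abs]
      exact pow_le_pow_left₀ (abs_nonneg _) (k2r_abs_inner_sub_le p.1 p.2 _ hω) 2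
    have h2 : |⟪p.1 + p.2, (ω : V3)⟫_ℝ / 2| ≤ X := by
      rw [abs_div, abs_two]
      have := k2r_abs_inner_add_le p.1 p.2 _ hω
      rw [← hX] at this
      linarith [abs_nonneg ⟪p.1 + p.2, (ω : V3)⟫_ℝ]
    rw [abs_mul, one_mul, pow_succ]
    exact mul_le_mul h1 h2 (abs_nonneg _) (by positivity)
  have hHi : Integrable H vol2 := by
    have hc : Continuous fun p : V3 × V3 =>
        max ⟪p.1 - p.2, (ω : V3)⟫_ℝ 0 * ⟪p.1 - p.2, (ω : V3)⟫_ℝ *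
          (⟪(p.1 - u) + (p.2 - u), (ω : V3)⟫_ℝ / 2) :=
      hk.mul ((((continuous_fst.sub continuous_const).add
        (continuous_snd.sub continuous_const)).inner continuous_const).div_const _)
    refine k2r_integrable_weight_mul_localMaxwellian_prod hθ hθ u u hc.aestronglyMeasurable
      (C := 1 + ‖u‖) (m := 3) (fun p => ?_)
    set X : ℝ := (1 + ‖p.1‖) * (1 + ‖p.2‖) with hX
    have hX1 : 1 ≤ X := by
      rw [hX]; nlinarith [norm_nonneg p.1, norm_nonneg p.2, mul_nonneg (norm_nonneg p.1) (norm_nonneg p.2)]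
    have h1 : |max ⟪p.1 - p.2, (ω : V3)⟫_ℝ 0 * ⟪p.1 - p.2, (ω : V3)⟫_ℝ| ≤ X ^ 2 := by
      refine (k2r_abs_posMul_le _).trans ?_
      rw [← sq_abs]
      exact pow_le_pow_left₀ (abs_nonneg _) (k2r_abs_inner_sub_le p.1 p.2 _ hω) 2
    have h2 : |⟪(p.1 - u) + (p.2 - u), (ω : V3)⟫_ℝ / 2| ≤ (1 + ‖u‖) * X := by
      rw [abs_div, abs_two]
      have h3 : |⟪(p.1 - u) + (p.2 - u), (ω : V3)⟫_ℝ| ≤ ‖p.1‖ + ‖p.2‖ + 2 * ‖u‖ := by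
        calc |⟪(p.1 - u) + (p.2 - u), (ω : V3)⟫_ℝ| ≤ ‖(p.1 - u) + (p.2 - u)‖ * ‖(ω : V3)‖ :=
              abs_real_inner_le_norm _ _
          _ ≤ (‖p.1 - u‖ + ‖p.2 - u‖) * 1 := by
              rw [hω]; exact mul_le_mul_of_nonneg_right (norm_add_le _ _) zero_le_one
          _ ≤ (‖p.1‖ + ‖u‖ + (‖p.2‖ + ‖u‖)) * 1 := by
              gcongr <;> exact norm_sub_le _ _
          _ = ‖p.1‖ + ‖p.2‖ + 2 * ‖u‖ := by ring
      have h4 : ‖p.1‖ + ‖p.2‖ ≤ X := by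
        rw [hX]; nlinarith [norm_nonneg p.1, norm_nonneg p.2, mul_nonneg (norm_nonneg p.1) (norm_nonneg p.2)]
      nlinarith [abs_nonneg ⟪(p.1 - u) + (p.2 - u), (ω : V3)⟫_ℝ, norm_nonneg u]
    rw [abs_mul, pow_succ, show (1 + ‖u‖) * (X ^ 2 * X) = X ^ 2 * ((1 + ‖u‖) * X) by ring]
    exact mul_le_mul h1 h2 (abs_nonneg _) (by positivity)
  -- the registered iterated integral is the product integral of `G`
  have hJG : (∫ v, ∫ w, max ⟪v - w, (ω : V3)⟫_ℝ 0 * ⟪v - w, (ω : V3)⟫_ℝ * (⟪v + w, (ω : V3)⟫_ℝ / 2) *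
      (M v * M w)) = ∫ p, G p ∂vol2 := (integral_prod G hGi).symm
  -- decomposition `G = (u·ω) F + H`
  have hdec : ∀ p : V3 × V3, G p = ⟪u, (ω : V3)⟫_ℝ * F p + H p := by
    intro p
    simp only [hF, hG, hH]
    have : ⟪p.1 + p.2, (ω : V3)⟫_ℝ = 2 * ⟪u, (ω : V3)⟫_ℝ + ⟪(p.1 - u) + (p.2 - u), (ω : V3)⟫_ℝ := by
      rw [show p.1 - u + (p.2 - u) = (p.1 + p.2) - (2 : ℝ) • u by module, inner_sub_left,
        real_inner_smul_left]
      ring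
    rw [this]
    ring
  have hGval : ∫ p, G p ∂vol2 = ⟪u, (ω : V3)⟫_ℝ * ∫ p, F p ∂vol2 + ∫ p, H p ∂vol2 := by
    have hFi' : Integrable (fun p : V3 × V3 => ⟪u, (ω : V3)⟫_ℝ * F p) vol2 := hFi.const_mul _
    calc ∫ p, G p ∂vol2 = ∫ p, (⟪u, (ω : V3)⟫_ℝ * F p + H p) ∂vol2 :=
          integral_congr_ae (Eventually.of_forall hdec)
      _ = (∫ p, ⟪u, (ω : V3)⟫_ℝ * F p ∂vol2) + ∫ p, H p ∂vol2 := integral_add hFi' hHi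
      _ = ⟪u, (ω : V3)⟫_ℝ * ∫ p, F p ∂vol2 + ∫ p, H p ∂vol2 := by rw [integral_const_mul]
  -- `∫ F = θ` by part (i)
  have hFval : ∫ p, F p ∂vol2 = θ := by
    rw [integral_prod F hFi]
    exact k2r_pairGaussian_fst hθ u ω
  -- `∫ H = 0` by the reflection `(v, w) ↦ (2u − w, 2u − v)`
  have hH0 : ∫ p, H p ∂vol2 = 0 := by
    have h1 : ∫ p, H p ∂vol2 = ∫ v, ∫ w, H (v, w) := integral_prod H hHi
    have h2 : ∫ p, H p ∂vol2 = ∫ v, ∫ w, H (w, v) := integral_prod_symm H hHi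
    have h3 : (∫ v, ∫ w, H (v, w)) = ∫ v, ∫ w, H ((2 : ℝ) • u - v, (2 : ℝ) • u - w) := by
      rw [← integral_sub_left_eq_self (fun v => ∫ w, H (v, w)) volume ((2 : ℝ) • u)]
      refine integral_congr_ae (Eventually.of_forall fun v => ?_)
      exact (integral_sub_left_eq_self (fun w => H ((2 : ℝ) • u - v, w)) volume ((2 : ℝ) • u)).symm
    have h4 : ∀ v w : V3, H ((2 : ℝ) • u - v, (2 : ℝ) • u - w) = -H (w, v) := by
      intro v w
      simp only [hH, hM]
      rw [sub_sub_sub_cancel_left, k2r_localMaxwellian_two_smul_sub, k2r_localMaxwellian_two_smul_sub,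
        show (2 : ℝ) • u - v - u + ((2 : ℝ) • u - w - u) = -((w - u) + (v - u)) by module,
        inner_neg_left]
      ring
    have h5 : (∫ v, ∫ w, H ((2 : ℝ) • u - v, (2 : ℝ) • u - w)) = -∫ v, ∫ w, H (w, v) := by
      simp_rw [h4, integral_neg]
    linarith [h1, h2, h3, h5]
  rw [hJG, hGval, hFval, hH0, add_zero, mul_comm]

end Equal


/-! ## Registered sub-goal of `stub_pairGaussian` carried by this file -/

/-- **Registered sub-goal `stub_pairGaussian_equal`** (helper 2 of 3 of stub `stub_pairGaussian`, line birth of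
K2R): clauses (i)–(ii) of `PairGaussian` — `∫∫ q₊ q M(v)M(w) = θ` and `∫∫ q₊ q ((v+w)·ω/2) M(v)M(w) = θ (u·ω)`
for `M = M_{1,θ,u}`, `θ > 0`, `ω ∈ S²` — verbatim registered signature, proved by `k2r_pairGaussian_fst/snd`.
[cite: CIP1994, §3.1] -/
theorem stub_pairGaussian_equal : ∀ (θ : ℝ), 0 < θ → ∀ (u : EuclideanSpace ℝ (Fin 3)) (ω : Metric.sphere (0 : EuclideanSpace ℝ (Fin 3)) 1), (∫ v : EuclideanSpace ℝ (Fin 3), ∫ w : EuclideanSpace ℝ (Fin 3), max (inner ℝ (v - w) ω) 0 * inner ℝ (v - w) ω * (Literature.Analysis.FluidPDE.localMaxwellian 1 θ u v * Literature.Analysis.FluidPDE.localMaxwellian 1 θ u w)) = θ ∧ (∫ v : EuclideanSpace ℝ (Fin 3), ∫ w : EuclideanSpace ℝ (Fin 3), max (inner ℝ (v - w) ω) 0 * inner ℝ (v - w) ω * (inner ℝ (v + w) ω / 2) * (Literature.Analysis.FluidPDE.localMaxwellian 1 θ u v * Literature.Analysis.FluidPDE.localMaxwellian 1 θ u w)) =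 θ * inner ℝ u ω :=
  fun _θ hθ u ω => ⟨k2r_pairGaussian_fst hθ u ω, k2r_pairGaussian_snd hθ u ω⟩

end Summit.AtomisticToContinuum.HydrodynamicLimit.Theorems.EnskogAdjointDuality

end
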